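import Literature.Analysis.FluidPDE.SpaceTimeRescaling
import Literature.Analysis.FluidPDE.WeakSolutionProofs
import HarnessLib

/-!
# Suitable weak solutions: restriction of the domain and Navier–Stokes rescaling

Trunk T-FLUID (`Literature/Analysis/FluidPDE`), proofs layer over the accepted structure
`Fluid.IsSuitableWeakSolutionOn` (`SuitableWeak.lean`; Caffarelli–Kohn–Nirenberg 1982, §2,
(2.1)–(2.5); Lin 1998, Def. 1). No new definitions.

* `IsSuitableWeakSolutionOn.mono_holds` **discharges** the named fact
  `Fluid.IsSuitableWeakSolutionOn.mono` of `SuitableWeak.lean` (restriction to an open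
  `Q' ≤ Q`; usable form `IsSuitableWeakSolutionOn.of_le`): every conjunct is local — the
  distributional equations restrict by the accepted `IsDistributionalNSSolutionOn.of_le`
  (`WeakSolutionProofs.lean`), compact subsets of `Q'` are compact subsets of `Q`, the weak
  spatial gradient restricts (`HasWeakSpatialGradientOn.mono`), and nonnegative test functions on
  `Q'` are nonnegative test functions on `Q` (`IsSpaceTimeTestOn.mono`). The statement was found
  faithful as vendored.
* `IsSuitableWeakSolutionOn.stRescale`: **covariance under the space–time rescaling**
  `w = α u ∘ Φ`, `q = α² p ∘ Φ`, `g = α² γ f ∘ Φ`, `Φ(s, y) = (t₀ + β s, x₀ + γ y)`, `β = α γ`,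
  `α, γ > 0`, new viscosity `α ν / γ`, new domain `Φ⁻¹(Q)` — the companion of the accepted
  `IsDistributionalNSSolutionOn.stRescale` and `HasWeakSpatialGradientOn.stRescale`
  (`SpaceTimeRescaling.lean`) for the remaining conjuncts of CKN's definition: the local classes
  `u ∈ L^∞_t L²_x`, `∇u ∈ L²`, `p ∈ L^{3/2}` on compact sets (transported along `Φ`, which maps
  compact subsets of `Φ⁻¹(Q)` onto compact subsets of `Q` and scales Lebesgue measure by
  `β γⁿ`), and the local energy inequality (2.5): tested with `φ ∈ C_c^∞(Φ⁻¹(Q))`, `φ ≥ 0`, each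
  of its terms equals `α³ γ (β γⁿ)⁻¹` times the corresponding term of (2.5) for `(u, p)` tested
  with `φ ∘ Φ⁻¹ ∈ C_c^∞(Q)`, by the chain rules `∂ₛ(φ' ∘ Φ) = β ∂ₜφ' ∘ Φ`,
  `∇(φ' ∘ Φ) = γ ∇φ' ∘ Φ`, `Δ(φ' ∘ Φ) = γ² Δφ' ∘ Φ` and the change of variables. For
  `α = γ = λ`, `β = λ²` this is the Navier–Stokes scaling `v_λ(x, t) = λ v(λ x, λ² t)`,
  `q_λ = λ² q(λ x, λ² t)` under which "suitable weak solution" is invariant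
  (Caffarelli–Kohn–Nirenberg 1982, §2, scaling remarks after (2.6); Lin 1998, §1;
  Escauriaza–Seregin–Šverák 2003, §3; used tacitly in Albritton–Barker 2019, §3).

## References

* L. Caffarelli, R. Kohn, L. Nirenberg, *Partial regularity of suitable weak solutions of the
  Navier–Stokes equations*, Comm. Pure Appl. Math. 35 (1982), 771–831, §2.
* F. Lin, *A new proof of the Caffarelli–Kohn–Nirenberg theorem*, Comm. Pure Appl. Math. 51
  (1998), 241–257, §1 and Def. 1.
* L. Escauriaza, G. Seregin, V. Šverák, *`L_{3,∞}`-solutions of Navier–Stokes equations and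
  backward uniqueness*, Russian Math. Surveys 58 (2003), §3.
* D. Albritton, T. Barker, *On local Type I singularities of the Navier–Stokes equations and
  Liouville theorems*, J. Math. Fluid Mech. 21 (2019), arXiv:1811.00502, §3.
-/

noncomputable section

open MeasureTheory TopologicalSpace Set Function Filter Topology Module Metric
open scoped InnerProductSpace RealInnerProductSpace ENNReal NNReal Laplacian

namespace Literature.Analysis.FluidPDE

variable {E : Type*} [NormedAddCommGroup E] [InnerProductSpace ℝ E] [FiniteDimensional ℝ E]
  [MeasurableSpace E] [BorelSpace E]

/-! ### Restriction of the domain (discharge of `IsSuitableWeakSolutionOn.mono`) -/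

section Mono

variable {Q Q' : Opens (ℝ × E)} {ν : ℝ} {f u : ℝ → E → E} {p : ℝ → E → ℝ}

/-- **Discharge of `Fluid.IsSuitableWeakSolutionOn.mono`** (`SuitableWeak.lean`;
Caffarelli–Kohn–Nirenberg 1982, §2): a suitable weak solution on the open region `Q` is a
suitable weak solution on every open `Q' ≤ Q`. All conjuncts are local: the distributional
equations restrict (`IsDistributionalNSSolutionOn.of_le`), compact subsets of `Q'` are compact
subsets of `Q` (energy class, pressure class, `∇u ∈ L²_loc`), the weak spatial gradient
restricts (`HasWeakSpatialGradientOn.mono`), and a nonnegative test function on `Q'` is one on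
`Q`, so the local energy inequality (2.5) on `Q'` is an instance of the one on `Q`.
[cite: CaffarelliKohnNirenberg1982, §2] -/
theorem IsSuitableWeakSolutionOn.mono_holds :
    IsSuitableWeakSolutionOn.mono (Q := Q) (Q' := Q') (ν := ν) (f := f) (u := u) (p := p) := by
  intro h hQ
  have hQs : ((Q' : Opens (ℝ × E)) : Set (ℝ × E)) ⊆ (Q : Set (ℝ × E)) := hQ
  obtain ⟨G, hG, hG2, hloc⟩ := h.localEnergy
  exact
    { distributional := h.distributional.of_le hQ
      energyClass := fun K hK hKc => h.energyClass K (hK.trans hQs) hKc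
      pressure := fun K hK hKc => h.pressure K (hK.trans hQs) hKc
      localEnergy := ⟨G, hG.mono hQ, fun K hK hKc => hG2 K (hK.trans hQs) hKc,
        fun φ hφ hφ0 => hloc φ (hφ.mono hQ) hφ0⟩ }

/-- The restriction of a suitable weak solution to a smaller open region, as a usable lemma
(`IsSuitableWeakSolutionOn.mono_holds`; Caffarelli–Kohn–Nirenberg 1982, §2).
[cite: CaffarelliKohnNirenberg1982, §2] -/
theorem IsSuitableWeakSolutionOn.of_le (h : IsSuitableWeakSolutionOn Q ν f u p) (hQ : Q' ≤ Q) :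
    IsSuitableWeakSolutionOn Q' ν f u p :=
  IsSuitableWeakSolutionOn.mono_holds h hQ

end Mono

/-! ### Covariance under the Navier–Stokes rescaling -/

section Rescale

omit [FiniteDimensional ℝ E] [MeasurableSpace E] [BorelSpace E] in
/-- `Φ = stAffine β γ t₀ x₀` is injective for `β, γ ≠ 0` (it is a homeomorphism). [folklore] -/
theorem injective_stAffine {β γ : ℝ} (hβ : β ≠ 0) (hγ : γ ≠ 0) (t₀ : ℝ) (x₀ : E) :
    Injective (stAffine β γ t₀ x₀) :=
  (stAffineHomeomorph hβ hγ t₀ x₀).injective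

omit [FiniteDimensional ℝ E] [MeasurableSpace E] [BorelSpace E] in
/-- A subset of `Φ⁻¹(Q)` is the preimage of its (compact, if it is compact) image, which lies in
`Q`. [folklore] -/
theorem eq_preimage_image_stAffine {β γ : ℝ} (hβ : β ≠ 0) (hγ : γ ≠ 0) (t₀ : ℝ) (x₀ : E)
    (K : Set (ℝ × E)) : K = stAffine β γ t₀ x₀ ⁻¹' (stAffine β γ t₀ x₀ '' K) :=
  (preimage_image_eq K (injective_stAffine hβ hγ t₀ x₀)).symm

omit [FiniteDimensional ℝ E] [MeasurableSpace E] [BorelSpace E] in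
/-- Indicators are transported along the injective map `Φ`:
`𝟙_K(z) F(Φ z) = 𝟙_{Φ(K)}(Φ z) F(Φ z)`, in the form needed for the energy class. [folklore] -/
theorem indicator_comp_stAffine_eq {β γ : ℝ} (hβ : β ≠ 0) (hγ : γ ≠ 0) (t₀ : ℝ) (x₀ : E)
    (K : Set (ℝ × E)) (F : ℝ × E → ℝ≥0∞) (z : ℝ × E) :
    K.indicator (F ∘ stAffine β γ t₀ x₀) z =
      (stAffine β γ t₀ x₀ '' K).indicator F (stAffine β γ t₀ x₀ z) := by
  by_cases hz : z ∈ K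
  · rw [indicator_of_mem hz, indicator_of_mem (mem_image_of_mem _ hz), comp_apply]
  · rw [indicator_of_notMem hz, indicator_of_notMem]
    exact fun h => hz (((injective_stAffine hβ hγ t₀ x₀).mem_set_image).1 h)

/-- **Covariance of suitable weak solutions under space–time rescaling.** If `(u, p)` is a
suitable weak solution with viscosity `ν` and force `f` on the open region `Q ⊆ ℝ × E`
(Caffarelli–Kohn–Nirenberg 1982, (2.1)–(2.5)), then for `α, γ > 0`, `β = α γ` and
`Φ(s, y) = (t₀ + β s, x₀ + γ y)` the pair `w = α u ∘ Φ`, `q = α² p ∘ Φ` is a suitable weak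
solution on `Φ⁻¹(Q)` with viscosity `α ν / γ` and force `α² γ f ∘ Φ`: the distributional
equations and the weak spatial gradient `(α γ) ∇u ∘ Φ` are covariant
(`IsDistributionalNSSolutionOn.stRescale`, `HasWeakSpatialGradientOn.stRescale`), the local
classes `L^∞_t L²_x`, `L²` (gradient), `L^{3/2}` (pressure) on compact `K ⊆ Φ⁻¹(Q)` follow from
those on the compact `Φ(K) ⊆ Q` by the change of variables, and the local energy inequality
(2.5) tested with `φ ∈ C_c^∞(Φ⁻¹(Q))`, `φ ≥ 0`, is `α³ γ (β γⁿ)⁻¹` times (2.5) for `(u, p)`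
tested with `φ ∘ Φ⁻¹`. For `α = γ = λ`, `β = λ²` (viscosity unchanged) this is the invariance of
suitable weak solutions under the Navier–Stokes scaling `v_λ(x, t) = λ v(λx, λ²t)`,
`q_λ = λ² q(λx, λ²t)` (CKN 1982, §2; Lin 1998, §1; Escauriaza–Seregin–Šverák 2003, §3).
[cite: CaffarelliKohnNirenberg1982, §2] -/
theorem IsSuitableWeakSolutionOn.stRescale {Q : Opens (ℝ × E)} {ν : ℝ} {f u : ℝ → E → E}
    {p : ℝ → E → ℝ} (h : IsSuitableWeakSolutionOn Q ν f u p) {α β γ : ℝ} (hα : 0 < α)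
    (hγ : 0 < γ) (hβ : β = α * γ) (t₀ : ℝ) (x₀ : E) :
    IsSuitableWeakSolutionOn (stPreimage β γ t₀ x₀ Q) (α * ν / γ)
      ((α ^ 2 * γ) • stPull β γ t₀ x₀ f) (α • stPull β γ t₀ x₀ u)
      (α ^ 2 • stPull β γ t₀ x₀ p) := by
  have hβ0 : 0 < β := by rw [hβ]; positivity
  set Φ := stAffine β γ t₀ x₀ with hΦ
  have hcont : Continuous Φ := continuous_stAffine β γ t₀ x₀
  -- images of compact subsets of `Φ⁻¹(Q)` are compact subsets of `Q`
  have himg : ∀ K ⊆ ((stPreimage β γ t₀ x₀ Q : Opens (ℝ × E)) : Set (ℝ × E)), IsCompact K →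
      Φ '' K ⊆ (Q : Set (ℝ × E)) ∧ IsCompact (Φ '' K) :=
    fun K hK hKc => ⟨image_subset_iff.2 hK, hKc.image hcont⟩
  obtain ⟨G, hG, hG2, hloc⟩ := h.localEnergy
  refine
    { distributional := h.distributional.stRescale hα hγ hβ t₀ x₀
      energyClass := ?_
      pressure := ?_
      localEnergy := ⟨(α * γ) • stPull β γ t₀ x₀ G, hG.stRescale α hβ0 hγ t₀ x₀, ?_, ?_⟩ }
  · -- `w ∈ L^∞_t L²_x` on compact sets
    intro K hK hKc
    obtain ⟨hK'Q, hK'c⟩ := himg K hK hKc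
    obtain ⟨C, hC⟩ := h.energyClass (Φ '' K) hK'Q hK'c
    set F : ℝ × E → ℝ≥0∞ := fun z => ‖u z.1 z.2‖ₑ ^ 2 with hF
    have h2 : ∀ᵐ s : ℝ, ∫⁻ x, (Φ '' K).indicator F (t₀ + β * s, x) ≤ C :=
      (quasiMeasurePreserving_time_affine hβ0 t₀).ae hC
    set C₁ : ℝ≥0∞ := ‖α‖ₑ ^ 2 * (ENNReal.ofReal (γ ^ finrank ℝ E)⁻¹ * C) with hC₁
    have hC₁top : C₁ ≠ ∞ :=
      ENNReal.mul_ne_top (by simp) (ENNReal.mul_ne_top ENNReal.ofReal_ne_top ENNReal.coe_ne_top)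
    refine ⟨C₁.toNNReal, ?_⟩
    rw [ENNReal.coe_toNNReal hC₁top]
    filter_upwards [h2] with s hs
    have key : ∀ y : E,
        K.indicator (fun z : ℝ × E => ‖(α • stPull β γ t₀ x₀ u) z.1 z.2‖ₑ ^ 2) (s, y) =
          ‖α‖ₑ ^ 2 * (Φ '' K).indicator F (t₀ + β * s, x₀ + γ • y) := by
      intro y
      have e1 : (fun z : ℝ × E => ‖(α • stPull β γ t₀ x₀ u) z.1 z.2‖ₑ ^ 2) =
          fun z => ‖α‖ₑ ^ 2 * (F ∘ Φ) z := by
        funext z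
        rw [smul_stPull_apply, enorm_smul, mul_pow]
        rfl
      rw [e1]
      have e2 : K.indicator (fun z => ‖α‖ₑ ^ 2 * (F ∘ Φ) z) (s, y) =
          ‖α‖ₑ ^ 2 * K.indicator (F ∘ Φ) (s, y) := by
        by_cases hz : ((s, y) : ℝ × E) ∈ K
        · rw [indicator_of_mem hz, indicator_of_mem hz]
        · rw [indicator_of_notMem hz, indicator_of_notMem hz, mul_zero]
      rw [e2, indicator_comp_stAffine_eq hβ0.ne' hγ.ne' t₀ x₀ K F (s, y)]
      rfl
    simp_rw [key]
    rw [lintegral_const_mul' _ _ (by simp),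
      lintegral_comp_space_affine hγ x₀ (fun x => (Φ '' K).indicator F (t₀ + β * s, x))]
    exact mul_le_mul' le_rfl (mul_le_mul' le_rfl hs)
  · -- `q ∈ L^{3/2}` on compact sets
    intro K hK hKc
    obtain ⟨hK'Q, hK'c⟩ := himg K hK hKc
    rw [eq_preimage_image_stAffine hβ0.ne' hγ.ne' t₀ x₀ K,
      setLIntegral_enorm_rpow_stRescale hβ0 hγ t₀ x₀ (α ^ 2) p _ (by norm_num)]
    exact ENNReal.mul_lt_top (ENNReal.mul_lt_top
      (ENNReal.rpow_lt_top_of_nonneg (by norm_num) enorm_ne_top) ENNReal.ofReal_lt_top)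
      (h.pressure _ hK'Q hK'c)
  · -- `∇w ∈ L²` on compact sets
    intro K hK hKc
    obtain ⟨hK'Q, hK'c⟩ := himg K hK hKc
    rw [eq_preimage_image_stAffine hβ0.ne' hγ.ne' t₀ x₀ K,
      setLIntegral_frobeniusNormSq_stRescale hβ0 hγ]
    exact ENNReal.mul_lt_top (ENNReal.mul_lt_top ENNReal.ofReal_lt_top ENNReal.ofReal_lt_top)
      (hG2 _ hK'Q hK'c)
  · -- the local energy inequality
    intro φ hφ hφ0
    set φ' := stPull β⁻¹ γ⁻¹ (-(β⁻¹ * t₀)) (-(γ⁻¹ • x₀)) φ with hφ'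
    have hφ'Q : IsSpaceTimeTestOn Q φ' := hφ.stPull_symm hβ0.ne' hγ.ne'
    have hrepr : φ = stPull β γ t₀ x₀ φ' := (stPull_stPull_symm hβ0.ne' hγ.ne' t₀ x₀ φ).symm
    have hφ'0 : ∀ t x, 0 ≤ φ' t x := fun t x => hφ0 _ _
    have key := hloc φ' hφ'Q hφ'0
    -- the dissipation term
    set D : ℝ → E → ℝ := fun t x => frobeniusNormSq (G t x) * φ' t x with hD
    have keyD : ∀ s y, frobeniusNormSq (((α * γ) • stPull β γ t₀ x₀ G) s y) * φ s y =
        (α * γ) ^ 2 * D (t₀ + β * s) (x₀ + γ • y) := by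
      intro s y
      have e : ((α * γ) • stPull β γ t₀ x₀ G) s y = (α * γ) • G (t₀ + β * s) (x₀ + γ • y) :=
        rfl
      conv_lhs => rw [hrepr]
      rw [e, frobeniusNormSq_smul, stPull_apply, hD]
      ring
    -- the right-hand side
    set R : ℝ → E → ℝ := fun t x => ‖u t x‖ ^ 2 * (timeDeriv φ' t x + ν * Δ (φ' t) x) +
        (‖u t x‖ ^ 2 + 2 * p t x) * ⟪u t x, gradient (φ' t) x⟫ +
        2 * ⟪f t x, u t x⟫ * φ' t x with hR
    have keyR : ∀ s y,
        ‖(α • stPull β γ t₀ x₀ u) s y‖ ^ 2 *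
            (timeDeriv φ s y + α * ν / γ * Δ (φ s) y) +
          (‖(α • stPull β γ t₀ x₀ u) s y‖ ^ 2 + 2 * (α ^ 2 • stPull β γ t₀ x₀ p) s y) *
            ⟪(α • stPull β γ t₀ x₀ u) s y, gradient (φ s) y⟫ +
          2 * ⟪((α ^ 2 * γ) • stPull β γ t₀ x₀ f) s y, (α • stPull β γ t₀ x₀ u) s y⟫ * φ s y =
        (α ^ 3 * γ) * R (t₀ + β * s) (x₀ + γ • y) := by
      intro s y
      conv_lhs => rw [hrepr]
      rw [timeDeriv_stPull, laplacian_stPull _ _ _ _ _ _ _ (hφ'Q.contDiff_slice_two _),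
        gradient_stPull, smul_stPull_apply, smul_stPull_apply, smul_stPull_apply, stPull_apply,
        hR]
      simp only [smul_eq_mul, norm_smul, Real.norm_eq_abs, abs_of_pos hα, mul_pow,
        real_inner_smul_left, real_inner_smul_right]
      rw [hβ]
      field_simp
    simp_rw [keyD, keyR, integral_const_mul]
    rw [integral_integral_comp_stAffine hβ0 hγ t₀ x₀ D,
      integral_integral_comp_stAffine hβ0 hγ t₀ x₀ R]
    simp only [smul_eq_mul]
    have hc : 0 ≤ α ^ 3 * γ * (β * γ ^ finrank ℝ E)⁻¹ := by positivity
    have key' := mul_le_mul_of_nonneg_left key hc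
    have e1 : 2 * (α * ν / γ) * ((α * γ) ^ 2 * ((β * γ ^ finrank ℝ E)⁻¹ * ∫ t, ∫ x, D t x)) =
        α ^ 3 * γ * (β * γ ^ finrank ℝ E)⁻¹ * (2 * ν * ∫ t, ∫ x, D t x) := by
      field_simp
    have e2 : α ^ 3 * γ * ((β * γ ^ finrank ℝ E)⁻¹ * ∫ t, ∫ x, R t x) =
        α ^ 3 * γ * (β * γ ^ finrank ℝ E)⁻¹ * ∫ t, ∫ x, R t x := by ring
    rw [e1, e2]
    exact key'

end Rescale

end Literature.Analysis.FluidPDE
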